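import Literature.AlgebraicGeometry.Frobenioids.IsometricPreSteps
import HarnessLib

/-!
# Frobenioids I, Proposition 1.9 (ii): the functor `φ_*` on isometric pre-steps; `O^×(A)^{imtr-pre}`

Mochizuki, *The geometry of Frobenioids I: the general theory*, Kyushu J. Math. **62** (2008)
293–400, §1, Proposition 1.9 (ii) and its proof, kurims text pp. 31–33
[cite: MochizukiFrdI2008, Prop. 1.9(ii)]. Standing data: `C → F_Φ` a Frobenioid (`hF`).

> "(ii) Any base-isomorphism `φ : A → B` of `C` induces a functor [well-defined up to
> isomorphism] `φ_* : C^imtr-pre_A → C^imtr-pre_B` that maps an isometric pre-step `C → A` to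
> the isometric pre-step `D → B` appearing in the factorization `C → D → B` of (i) applied to
> the composite of the given pre-step `C → A` with `φ : A → B`. Moreover, if `φ` is a co-angular
> pre-step, then `φ_*` is an equivalence of categories. If `u ∈ O^×(A)`, then we shall denote by
> `u^imtr-pre` the isomorphism class of the self-equivalence of the category `C^imtr-pre_A`
> induced by `u` and by `O^×(A)^imtr-pre ⊆ O^×(A)` the subgroup of `v ∈ O^×(A)` for which
> `v^imtr-pre` is the identity."

Everything is PROVED along the printed proof (p. 32–33): existence of `φ_*` from the
factorisation (i); "well-defined up to isomorphism"; for a co-angular pre-step `φ`, `φ_*` is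
essentially surjective and full by the construction "given `β`, `φ`, of `α`, `ψ` such that
`β ∘ ψ = φ ∘ α`" via Def. 1.3 (iii)(d) and (v)(c), and faithful since pre-steps are monomorphisms.

Renderings (recorded for the referee). `φ_*` is characterised by the property
`IsPushforwardAlong F φ Ψ` ("`Ψ` sends `ι : X → A` to the isometric pre-step of a factorisation
(i) of `φ ∘ ι`"); we prove such a `Ψ` exists and that any two are isomorphic — the value of `Ψ` on
arrows needs no separate description because `C^imtr-pre_B` has at most one arrow between any two
objects (pre-steps are monomorphisms). For `u ∈ O^×(A)` "the self-equivalence induced by `u`" is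
post-composition `u_! = Over.map u` (it satisfies `IsPushforwardAlong F u`), `u^imtr-pre` is its
isomorphism class, and `O^×(A)^imtr-pre` is the subgroup of those `v` with `v_! ≅ 𝟭`; the
characterisation `mem_unitsSubgroupImtrPre_iff` spells this out on isometric pre-steps `X → A`.
No statement of the paper is strengthened.
-/

namespace Literature.AlgebraicGeometry.Frobenioids

open CategoryTheory Opposite

universe w v v' u u'

namespace PreFrobenioid

variable {D : Type u} [Category.{v} D] {Φ : Dᵒᵖ ⥤ CommMonCat.{w}}
  {C : Type u'} [Category.{v'} C] (F : C ⥤ ElemFrobenioid Φ)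

/-! ### The defining property of `φ_*` -/

/-- `Ψ : C^imtr-pre_A → C^imtr-pre_B` *is a push-forward along* the base-isomorphism `φ : A → B`
if it "maps an isometric pre-step `C → A` to the isometric pre-step `D → B` appearing in the
factorization `C → D → B` of (i) applied to the composite … with `φ`" (FrdI Prop. 1.9 (ii)): for
every `ι : X → A` there is a co-angular base-isomorphism `β` with `Ψ(ι) ∘ β = φ ∘ ι`.
[cite: MochizukiFrdI2008, Prop. 1.9(ii) p.31] -/
def IsPushforwardAlong {A B : C} (φ : A ⟶ B)
    (Ψ : Over (⟨A⟩ : ImtrPreCat F) ⥤ Over (⟨B⟩ : ImtrPreCat F)) : Prop :=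
  ∀ U : Over (⟨A⟩ : ImtrPreCat F), ∃ β : U.left.obj ⟶ (Ψ.obj U).left.obj,
    (IsCoAngular F β ∧ IsBaseIso F β) ∧ β ≫ (Ψ.obj U).hom.1 = U.hom.1 ≫ φ

variable {F}

/-- A functor into a category with at most one arrow between any two objects is determined by
its object map and the existence of the required arrows. [cite: MochizukiFrdI2008, Prop. 1.9(ii) p.33] -/
private noncomputable def functorOfExistsHom {P : Type*} [Category P] {Q : Type*} [Category Q]
    (hQ : ∀ X Y : Q, Subsingleton (X ⟶ Y)) (obj : P → Q)
    (h : ∀ ⦃X Y : P⦄, (X ⟶ Y) → Nonempty (obj X ⟶ obj Y)) : P ⥤ Q where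
  obj := obj
  map f := (h f).some
  map_id X := by haveI := hQ (obj X) (obj X); exact Subsingleton.elim _ _
  map_comp {X Y Z} _ _ := by haveI := hQ (obj X) (obj Z); exact Subsingleton.elim _ _

/-- Co-angular pre-steps `ψ : X → A`, `ψ' : X' → A` with `(ψ^*)⁻¹ Div ψ = (ψ'^*)⁻¹ Div ψ'` are
isomorphic over `A` (the slice equivalence of Def. 1.3 (iii)(d), fullness in both directions,
together with (v)(a): pre-steps are monomorphisms). [cite: MochizukiFrdI2008, Prop. 1.9(ii) p.33] -/
theorem exists_iso_of_invDiv_eq (hF : IsFrobenioid F) {X X' A : C} (ψ : X ⟶ A) (ψ' : X' ⟶ A)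
    (h : IsCoAngularPreStep F ψ) (h' : IsCoAngularPreStep F ψ')
    (heq : invDiv F ψ h.2.2 = invDiv F ψ' h'.2.2) : ∃ e : X ≅ X', e.hom ≫ ψ' = ψ := by
  obtain ⟨g, -, hg⟩ := hF.iii_d_over_full ψ ψ' h h' (by rw [heq])
  obtain ⟨g', -, hg'⟩ := hF.iii_d_over_full ψ' ψ h' h (by rw [heq])
  haveI := hF.v_a ψ h.2
  haveI := hF.v_a ψ' h'.2
  have h1 : g ≫ g' = 𝟙 X := by
    rw [← cancel_mono ψ, Category.assoc, hg', hg, Category.id_comp]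
  have h2 : g' ≫ g = 𝟙 X' := by
    rw [← cancel_mono ψ', Category.assoc, hg, hg', Category.id_comp]
  exact ⟨⟨g, g', h1, h2⟩, hg⟩

/-- In a square `b ≫ a = ι ≫ φ` with `ι`, `φ` linear (e.g. `ι` an isometric pre-step and `φ` a
pre-step), a co-angular base-isomorphism `b` is a co-angular pre-step (degrees multiply,
Remark 1.1.1).
[cite: MochizukiFrdI2008, Prop. 1.9(ii) p.32] -/
theorem isCoAngularPreStep_of_square {X A Y B : C} {ι : X ⟶ A} {φ : A ⟶ B} {b : X ⟶ Y}
    {a : Y ⟶ B} (hsq : b ≫ a = ι ≫ φ) (hι : IsIsometricPreStep F ι) (hφ : IsPreStep F φ)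
    (hb : IsCoAngular F b ∧ IsBaseIso F b) : IsCoAngularPreStep F b := by
  have hlin : IsLinear F (b ≫ a) := by rw [hsq]; exact IsLinear.comp F hι.2.1 hφ.1
  exact ⟨hb.1, (isLinear_factors F hlin).2, hb.2⟩

/-- Base bookkeeping for a square `b ≫ a = ι ≫ φ` of base-isomorphisms:
`(Base b)⁻¹ ∘… ` — precisely `inv (Base b) ≫ Base ι = Base a ≫ inv (Base φ)`.
[cite: MochizukiFrdI2008, Prop. 1.9(ii) p.33] -/
theorem inv_base_comp_base_of_square {X A Y B : C} {ι : X ⟶ A} {φ : A ⟶ B} {b : X ⟶ Y}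
    {a : Y ⟶ B} (hsq : b ≫ a = ι ≫ φ) (hb : IsBaseIso F b) (hφ : IsBaseIso F φ) :
    haveI : IsIso (Base F b) := hb
    haveI : IsIso (Base F φ) := hφ
    inv (Base F b) ≫ Base F ι = Base F a ≫ inv (Base F φ) := by
  haveI : IsIso (Base F b) := hb
  haveI : IsIso (Base F φ) := hφ
  have h : Base F b ≫ Base F a = Base F ι ≫ Base F φ := by rw [← base_comp, hsq, base_comp]
  rw [IsIso.inv_comp_eq, ← Category.assoc, IsIso.eq_comp_inv, h]

/-- Divisor bookkeeping for a square `b ≫ a = ι ≫ φ` with `ι`, `a` isometric pre-steps: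
`Div(b) = (Base ι)^* Div(φ)`, hence `(b^*)⁻¹ Div b = (Base a ∘ (Base φ)⁻¹)^* Div φ`.
[cite: MochizukiFrdI2008, Prop. 1.9(ii) p.33] -/
theorem invDiv_eq_of_square {X A Y B : C} {ι : X ⟶ A} {φ : A ⟶ B} {b : X ⟶ Y} {a : Y ⟶ B}
    (hsq : b ≫ a = ι ≫ φ) (hι : IsIsometricPreStep F ι) (hφ : IsBaseIso F φ)
    (hb : IsBaseIso F b) (ha : IsIsometricPreStep F a) :
    haveI : IsIso (Base F φ) := hφ
    invDiv F b hb = pull Φ (Base F a ≫ inv (Base F φ)) (Div F φ) := by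
  haveI : IsIso (Base F φ) := hφ
  haveI : IsIso (Base F b) := hb
  have hdiv : Div F b = pull Φ (Base F ι) (Div F φ) := by
    have h1 : Div F (b ≫ a) = Div F b := by
      rw [div_comp, show Div F a = 1 from ha.1, map_one, one_mul, show degFr F a = 1 from ha.2.1,
        PNat.one_coe, pow_one]
    have h2 : Div F (ι ≫ φ) = pull Φ (Base F ι) (Div F φ) := by
      rw [div_comp, show Div F ι = 1 from hι.1, one_pow, mul_one]
    rw [← h1, hsq, h2]
  rw [← inv_base_comp_base_of_square hsq hb hφ, pull_comp, ← hdiv]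
  rfl

/-! ### The construction of p. 32–33 -/

/-- The construction in the proof of Prop. 1.9 (ii) (p. 32–33): for a co-angular pre-step
`φ₀ : A₀ → B₀` and an isometric pre-step `β₀ : Y₀ → B₀` "there exists a co-angular pre-step
`ψ₀ : X₀ → Y₀` such that `(Φ(β₀ ∘ ψ₀))⁻¹(Div ψ₀) = Φ(φ₀)⁻¹(Div φ₀)` [Def. 1.3 (iii)(d)]"
and then, by Def. 1.3 (v)(c) and (iii)(d) again, an isometric pre-step `α₀ : X₀ → A₀` with
`β₀ ∘ ψ₀ = φ₀ ∘ α₀`. [cite: MochizukiFrdI2008, Prop. 1.9(ii) p.32] -/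
theorem exists_square_of_isCoAngularPreStep (hF : IsFrobenioid F) {A₀ B₀ Y₀ : C} (φ₀ : A₀ ⟶ B₀)
    (hφ₀ : IsCoAngularPreStep F φ₀) (β₀ : Y₀ ⟶ B₀) (hβ₀ : IsIsometricPreStep F β₀) :
    ∃ (X₀ : C) (ψ₀ : X₀ ⟶ Y₀) (α₀ : X₀ ⟶ A₀) (hψ₀ : IsCoAngularPreStep F ψ₀),
      IsIsometricPreStep F α₀ ∧ ψ₀ ≫ β₀ = α₀ ≫ φ₀ ∧
        invDiv F ψ₀ hψ₀.2.2 = pull Φ (Base F β₀) (invDiv F φ₀ hφ₀.2.2) := by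
  have hP : IsPreFrobenioid Φ F := hF.isPreFrobenioid
  have hC : IsTotallyEpimorphic C := hP.isTotallyEpimorphic
  -- choose `ψ₀` with the prescribed `(ψ₀^*)⁻¹ Div ψ₀`
  obtain ⟨X₀, ψ₀, hψ₀, hx⟩ :=
    hF.iii_d_over_surj Y₀ (pull Φ (Base F β₀) (invDiv F φ₀ hφ₀.2.2))
  -- factor the pre-step `ψ₀ ≫ β₀` as isometric pre-step followed by co-angular pre-step
  have hpre : IsPreStep F (ψ₀ ≫ β₀) := IsPreStep.comp F hψ₀.2 hβ₀.2
  obtain ⟨A', α', φ', hfac, hα', hφ'⟩ := hF.v_c_exists (ψ₀ ≫ β₀) hpre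
  -- `(φ'^*)⁻¹ Div φ' = (φ₀^*)⁻¹ Div φ₀`
  haveI : IsIso (Base F φ₀) := hφ₀.2.2
  haveI : IsIso (Base F φ') := hφ'.2.2
  haveI : IsIso (Base F ψ₀) := hψ₀.2.2
  have hDψ : Div F (ψ₀ ≫ β₀) = Div F ψ₀ := by
    rw [div_comp, show Div F β₀ = 1 from hβ₀.1, map_one, one_mul, show degFr F β₀ = 1 from hβ₀.2.1,
      PNat.one_coe, pow_one]
  have hDα : Div F (α' ≫ φ') = pull Φ (Base F α') (Div F φ') := by
    rw [div_comp, show Div F α' = 1 from hα'.1, one_pow, mul_one]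
  have hbase : Base F ψ₀ ≫ Base F β₀ = Base F α' ≫ Base F φ' := by
    rw [← base_comp, ← hfac, base_comp]
  -- unwind the choice of `ψ₀`
  have hx' : Div F ψ₀ = pull Φ (Base F ψ₀ ≫ Base F β₀) (invDiv F φ₀ hφ₀.2.2) := by
    have := congrArg (pull Φ (Base F ψ₀)) hx
    rw [pull_invDiv] at this
    rw [this, pull_comp]
  have hDφ' : Div F φ' = pull Φ (Base F φ' ≫ inv (Base F φ₀)) (Div F φ₀) := by
    apply (hP.isMonoidOn.isCharInjective (Base F α')).1
    rw [← hDα, hfac, hDψ, hx', hbase, pull_comp, pull_comp]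
    rfl
  have hinv : invDiv F φ' hφ'.2.2 = invDiv F φ₀ hφ₀.2.2 := by
    show pull Φ (inv (Base F φ')) (Div F φ') = pull Φ (inv (Base F φ₀)) (Div F φ₀)
    rw [hDφ', ← pull_comp, ← Category.assoc, IsIso.inv_hom_id, Category.id_comp]
  -- hence `φ'` and `φ₀` are isomorphic over `B₀`
  obtain ⟨γ, hγ⟩ := exists_iso_of_invDiv_eq hF φ' φ₀ hφ' hφ₀ hinv
  refine ⟨X₀, ψ₀, α' ≫ γ.hom, hψ₀,
    IsIsometricPreStep.comp F hα' (isIsometricPreStep_of_isIso hP γ.hom), ?_, hx⟩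
  rw [Category.assoc, hγ, hfac]

/-! ### Proposition 1.9 (ii): existence and uniqueness of `φ_*` -/

/-- **Prop. 1.9 (ii)**, existence: a base-isomorphism `φ : A → B` induces a functor
`φ_* : C^imtr-pre_A → C^imtr-pre_B` sending `ι : X → A` to the isometric pre-step of the
factorisation (i) of `φ ∘ ι` ("The existence of the functor `φ_*` follows formally from the
existence of the (essentially) unique factorization of assertion (i)").
[cite: MochizukiFrdI2008, Prop. 1.9(ii) p.31] -/
theorem exists_pushforward (hF : IsFrobenioid F) {A B : C} (φ : A ⟶ B) (hφ : IsBaseIso F φ) :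
    ∃ Ψ : Over (⟨A⟩ : ImtrPreCat F) ⥤ Over (⟨B⟩ : ImtrPreCat F), IsPushforwardAlong F φ Ψ := by
  have hP : IsPreFrobenioid Φ F := hF.isPreFrobenioid
  -- choose a factorisation (i) of `ι ≫ φ` for every object `ι` of `C^imtr-pre_A`
  have hex : ∀ U : Over (⟨A⟩ : ImtrPreCat F), ∃ (Y : C) (b : U.left.obj ⟶ Y) (a : Y ⟶ B),
      b ≫ a = U.hom.1 ≫ φ ∧ (IsCoAngular F b ∧ IsBaseIso F b) ∧ IsIsometricPreStep F a :=
    fun U => exists_coAngular_isometricPreStep_factorization hF (U.hom.1 ≫ φ)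
      (IsBaseIso.comp F U.hom.2.2.2 hφ)
  choose Y b a hfac hb ha using hex
  let obj : Over (⟨A⟩ : ImtrPreCat F) → Over (⟨B⟩ : ImtrPreCat F) :=
    fun U => Over.mk (Y := (⟨Y U⟩ : ImtrPreCat F)) ⟨a U, ha U⟩
  -- arrows: from the uniqueness in (i)
  have hhom : ∀ ⦃U U' : Over (⟨A⟩ : ImtrPreCat F)⦄, (U ⟶ U') → Nonempty (obj U ⟶ obj U') := by
    intro U U' m
    have hm : m.left.1 ≫ U'.hom.1 = U.hom.1 := congrArg InducedWideCategory.Hom.hom (Over.w m)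
    -- factor `m ≫ b'` by (i) and compare with `(b, a)`
    obtain ⟨Y'', b'', a'', hfac'', hb'', ha''⟩ :=
      exists_coAngular_isometricPreStep_factorization hF (m.left.1 ≫ b U')
        (IsBaseIso.comp F m.left.2.2.2 (hb U').2)
    have hfac₂ : b'' ≫ (a'' ≫ a U') = U.hom.1 ≫ φ := by
      rw [← Category.assoc, hfac'', Category.assoc, hfac, ← Category.assoc, hm]
    obtain ⟨γ, -, hγ⟩ := coAngular_isometricPreStep_factorization_unique hF (U.hom.1 ≫ φ)
      (b U) (a U) b'' (a'' ≫ a U') (hfac U) (hb U) (ha U) hfac₂ hb''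
      (IsIsometricPreStep.comp F ha'' (ha U'))
    refine ⟨Over.homMk ⟨γ.hom ≫ a'', IsIsometricPreStep.comp F (isIsometricPreStep_of_isIso hP _)
      ha''⟩ (InducedWideCategory.Hom.ext ?_)⟩
    show (γ.hom ≫ a'') ≫ a U' = a U
    rw [Category.assoc, ← hγ]
  refine ⟨functorOfExistsHom (subsingleton_hom_over_imtrPre hF) obj hhom, fun U => ?_⟩
  exact ⟨b U, hb U, hfac U⟩

/-- **Prop. 1.9 (ii)**, "[well-defined up to isomorphism]": any two push-forwards along `φ` are
isomorphic functors (uniqueness in (i); naturality is automatic since `C^imtr-pre_B` has at most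
one arrow between two objects). [cite: MochizukiFrdI2008, Prop. 1.9(ii) p.31] -/
theorem pushforward_unique (hF : IsFrobenioid F) {A B : C} {φ : A ⟶ B}
    {Ψ Ψ' : Over (⟨A⟩ : ImtrPreCat F) ⥤ Over (⟨B⟩ : ImtrPreCat F)} (hΨ : IsPushforwardAlong F φ Ψ)
    (hΨ' : IsPushforwardAlong F φ Ψ') : Nonempty (Ψ ≅ Ψ') := by
  have hcomp : ∀ U, Nonempty (Ψ.obj U ≅ Ψ'.obj U) := by
    intro U
    obtain ⟨β, hβ, hsq⟩ := hΨ U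
    obtain ⟨β', hβ', hsq'⟩ := hΨ' U
    obtain ⟨γ, -, hγ⟩ := coAngular_isometricPreStep_factorization_unique hF (U.hom.1 ≫ φ) β
      (Ψ.obj U).hom.1 β' (Ψ'.obj U).hom.1 hsq hβ (Ψ.obj U).hom.2 hsq' hβ' (Ψ'.obj U).hom.2
    refine ⟨Over.isoMk (isoMk γ (isIsometricPreStep_of_isIso hF.isPreFrobenioid γ.hom)
      (isIsometricPreStep_of_isIso hF.isPreFrobenioid γ.inv)) (InducedWideCategory.Hom.ext ?_)⟩
    exact hγ.symm
  haveI : ∀ X Y : Over (⟨B⟩ : ImtrPreCat F), Subsingleton (X ⟶ Y) :=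
    subsingleton_hom_over_imtrPre hF
  exact ⟨NatIso.ofComponents (fun U => (hcomp U).some) (fun _ => Subsingleton.elim _ _)⟩

/-! ### Proposition 1.9 (ii): `φ_*` is an equivalence for a co-angular pre-step `φ` -/

/-- **Prop. 1.9 (ii)**, "Moreover, if `φ` is a co-angular pre-step, then `φ_*` is an equivalence of
categories": essential surjectivity (the construction of p. 32–33 with the uniqueness in (i)).
[cite: MochizukiFrdI2008, Prop. 1.9(ii) p.33] -/
theorem pushforward_essSurj (hF : IsFrobenioid F) {A B : C} {φ : A ⟶ B}
    (hφ : IsCoAngularPreStep F φ) {Ψ : Over (⟨A⟩ : ImtrPreCat F) ⥤ Over (⟨B⟩ : ImtrPreCat F)}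
    (hΨ : IsPushforwardAlong F φ Ψ) : Ψ.EssSurj := by
  have hP : IsPreFrobenioid Φ F := hF.isPreFrobenioid
  refine ⟨fun V => ?_⟩
  obtain ⟨X₀, ψ₀, α₀, hψ₀, hα₀, hsq, -⟩ := exists_square_of_isCoAngularPreStep hF φ hφ V.hom.1 V.hom.2
  let U : Over (⟨A⟩ : ImtrPreCat F) := Over.mk (Y := (⟨X₀⟩ : ImtrPreCat F)) ⟨α₀, hα₀⟩
  obtain ⟨β, hβ, hsqβ⟩ := hΨ U
  obtain ⟨γ, -, hγ⟩ := coAngular_isometricPreStep_factorization_unique hF (α₀ ≫ φ) β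
    (Ψ.obj U).hom.1 ψ₀ V.hom.1 hsqβ hβ (Ψ.obj U).hom.2 hsq ⟨hψ₀.1, hψ₀.2.2⟩ V.hom.2
  refine ⟨U, ⟨Over.isoMk (isoMk γ (isIsometricPreStep_of_isIso hP γ.hom)
    (isIsometricPreStep_of_isIso hP γ.inv)) (InducedWideCategory.Hom.ext ?_)⟩⟩
  exact hγ.symm

/-- **Prop. 1.9 (ii)**, equivalence: fullness ("[by possibly replacing `φ` by `ψ`] this argument …
also implies that `φ_*` is full", p. 33). [cite: MochizukiFrdI2008, Prop. 1.9(ii) p.33] -/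
theorem pushforward_full (hF : IsFrobenioid F) {A B : C} {φ : A ⟶ B}
    (hφ : IsCoAngularPreStep F φ) {Ψ : Over (⟨A⟩ : ImtrPreCat F) ⥤ Over (⟨B⟩ : ImtrPreCat F)}
    (hΨ : IsPushforwardAlong F φ Ψ) : Ψ.Full := by
  have hP : IsPreFrobenioid Φ F := hF.isPreFrobenioid
  refine ⟨fun {U U'} n => ?_⟩
  obtain ⟨b, hb, hsq⟩ := hΨ U
  obtain ⟨b', hb', hsq'⟩ := hΨ U'
  have hbc : IsCoAngularPreStep F b := isCoAngularPreStep_of_square hsq U.hom.2 hφ.2 hb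
  have hbc' : IsCoAngularPreStep F b' := isCoAngularPreStep_of_square hsq' U'.hom.2 hφ.2 hb'
  have hn : n.left.1 ≫ (Ψ.obj U').hom.1 = (Ψ.obj U).hom.1 :=
    congrArg InducedWideCategory.Hom.hom (Over.w n)
  -- the construction applied to the co-angular pre-step `b'` and the isometric pre-step `n`
  obtain ⟨X₁, ψ₁, α₁, hψ₁, hα₁, hsq₁, hx₁⟩ :=
    exists_square_of_isCoAngularPreStep hF b' hbc' n.left.1 n.left.2
  -- `(ψ₁^*)⁻¹ Div ψ₁ = (b^*)⁻¹ Div b`, both being `(Base a ∘ Base φ⁻¹)^* Div φ`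
  haveI : IsIso (Base F φ) := hφ.2.2
  have h1 : invDiv F b hb.2 = pull Φ (Base F (Ψ.obj U).hom.1 ≫ inv (Base F φ)) (Div F φ) :=
    invDiv_eq_of_square hsq U.hom.2 hφ.2.2 hb.2 (Ψ.obj U).hom.2
  have h2 : invDiv F b' hb'.2 = pull Φ (Base F (Ψ.obj U').hom.1 ≫ inv (Base F φ)) (Div F φ) :=
    invDiv_eq_of_square hsq' U'.hom.2 hφ.2.2 hb'.2 (Ψ.obj U').hom.2
  have heq : invDiv F ψ₁ hψ₁.2.2 = invDiv F b hbc.2.2 := by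
    rw [hx₁, h2, ← pull_comp, ← Category.assoc, ← base_comp, hn]
    exact h1.symm
  obtain ⟨e, he⟩ := exists_iso_of_invDiv_eq hF ψ₁ b hψ₁ hbc heq
  -- the arrow `e⁻¹ ≫ α₁ : X → X'` lies over `A` since `φ` is a monomorphism
  haveI := hF.v_a φ hφ.2
  have hm : (e.inv ≫ α₁) ≫ U'.hom.1 = U.hom.1 := by
    rw [← cancel_mono φ, Category.assoc, Category.assoc, ← hsq', ← reassoc_of% hsq₁,
      hn, ← he, Category.assoc, hsq, e.inv_hom_id_assoc]
  haveI := subsingleton_hom_over_imtrPre hF (Ψ.obj U) (Ψ.obj U')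
  exact ⟨Over.homMk ⟨e.inv ≫ α₁, IsIsometricPreStep.comp F (isIsometricPreStep_of_isIso hP e.inv)
    hα₁⟩ (InducedWideCategory.Hom.ext hm), Subsingleton.elim _ _⟩

/-- **Prop. 1.9 (ii)**, equivalence: faithfulness ("since every pre-step is a monomorphism
[cf. Definition 1.3, (v), (a)], it follows immediately that `φ_*` is faithful", p. 33).
[cite: MochizukiFrdI2008, Prop. 1.9(ii) p.33] -/
theorem pushforward_faithful (hF : IsFrobenioid F) {A B : C}
    (Ψ : Over (⟨A⟩ : ImtrPreCat F) ⥤ Over (⟨B⟩ : ImtrPreCat F)) : Ψ.Faithful :=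
  ⟨fun {U U'} _ _ _ => by haveI := subsingleton_hom_over_imtrPre hF U U'; exact Subsingleton.elim _ _⟩

/-- **Prop. 1.9 (ii)**: "if `φ` is a co-angular pre-step, then `φ_*` is an equivalence of
categories". [cite: MochizukiFrdI2008, Prop. 1.9(ii) p.31] -/
theorem pushforward_isEquivalence (hF : IsFrobenioid F) {A B : C} {φ : A ⟶ B}
    (hφ : IsCoAngularPreStep F φ) {Ψ : Over (⟨A⟩ : ImtrPreCat F) ⥤ Over (⟨B⟩ : ImtrPreCat F)}
    (hΨ : IsPushforwardAlong F φ Ψ) : Ψ.IsEquivalence where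
  faithful := pushforward_faithful hF Ψ
  full := pushforward_full hF hφ hΨ
  essSurj := pushforward_essSurj hF hφ hΨ

/-! ### `u^imtr-pre` and the subgroup `O^×(A)^imtr-pre` -/

/-- An automorphism `u` of `A` as an arrow of `C^imtr-pre` (isomorphisms are isometric
pre-steps). [cite: MochizukiFrdI2008, Prop. 1.9(ii) p.31] -/
def autToImtrPreHom (hP : IsPreFrobenioid Φ F) {A : C} (u : Aut A) :
    (⟨A⟩ : ImtrPreCat F) ⟶ ⟨A⟩ :=
  ⟨u.hom, isIsometricPreStep_of_isIso hP u.hom⟩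

/-- "the self-equivalence of the category `C^imtr-pre_A` induced by `u`" is post-composition
`u_! = Over.map u`: it is a push-forward along `u` in the sense of (ii) (with `β = id`).
[cite: MochizukiFrdI2008, Prop. 1.9(ii) p.31] -/
theorem isPushforwardAlong_overMap (hP : IsPreFrobenioid Φ F) {A : C} (u : Aut A) :
    IsPushforwardAlong F u.hom (Over.map (autToImtrPreHom hP u)) := fun U =>
  ⟨𝟙 _, ⟨isCoAngular_of_isIso F hP.isTotallyEpimorphic (𝟙 _), isBaseIso_of_isIso F (𝟙 _)⟩,
    by
      show 𝟙 U.left.obj ≫ (U.hom.1 ≫ u.hom) = U.hom.1 ≫ u.hom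
      exact Category.id_comp _⟩

/-- `O^×(A)^imtr-pre ⊆ O^×(A)`: "the subgroup of `v ∈ O^×(A)` for which `v^imtr-pre` is the
identity", i.e. for which the self-equivalence `v_!` of `C^imtr-pre_A` is isomorphic to the
identity functor (FrdI Prop. 1.9 (ii)). [cite: MochizukiFrdI2008, Prop. 1.9(ii) p.31] -/
def unitsSubgroupImtrPre (hP : IsPreFrobenioid Φ F) (A : C) : Subgroup (Aut A) where
  carrier := {v | v ∈ unitsSubgroup F A ∧ Nonempty (Over.map (autToImtrPreHom hP v) ≅ 𝟭 _)}
  one_mem' := ⟨(unitsSubgroup F A).one_mem, ⟨Over.mapId _⟩⟩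
  mul_mem' := by
    rintro v w ⟨hv, ⟨ev⟩⟩ ⟨hw, ⟨ew⟩⟩
    refine ⟨(unitsSubgroup F A).mul_mem hv hw, ⟨?_⟩⟩
    have h : autToImtrPreHom hP (v * w) = autToImtrPreHom hP w ≫ autToImtrPreHom hP v := rfl
    rw [h]
    exact Over.mapComp _ _ ≪≫ Functor.isoWhiskerRight ew _ ≪≫ Functor.leftUnitor _ ≪≫ ev
  inv_mem' := by
    rintro v ⟨hv, ⟨ev⟩⟩
    refine ⟨(unitsSubgroup F A).inv_mem hv, ⟨?_⟩⟩
    have h : autToImtrPreHom hP v⁻¹ ≫ autToImtrPreHom hP v = 𝟙 _ :=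
      InducedWideCategory.Hom.ext v.inv_hom_id
    exact (Functor.rightUnitor _).symm ≪≫ Functor.isoWhiskerLeft _ ev.symm ≪≫
      (Over.mapComp _ _).symm ≪≫ eqToIso (by rw [h]) ≪≫ Over.mapId _

/-- `O^×(A)^imtr-pre ⊆ O^×(A)`. [cite: MochizukiFrdI2008, Prop. 1.9(ii) p.31] -/
theorem unitsSubgroupImtrPre_le (hP : IsPreFrobenioid Φ F) (A : C) :
    unitsSubgroupImtrPre (F := F) hP A ≤ unitsSubgroup F A := fun _ h => h.1

/-- `v ∈ O^×(A)^imtr-pre` spelled out: `v ∈ O^×(A)` and every isometric pre-step `ι : X → A` is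
isomorphic over `A` to `v ∘ ι`, i.e. there is an automorphism `n` of `X` with `ι ∘ n = v ∘ ι`
(in a Frobenioid `C^imtr-pre_A` has at most one arrow between two objects, so `v_! ≅ 𝟭` is
equivalent to `v_!(ι) ≅ ι` for every `ι`). [cite: MochizukiFrdI2008, Prop. 1.9(ii) p.31] -/
theorem mem_unitsSubgroupImtrPre_iff (hF : IsFrobenioid F) {A : C} (v : Aut A) :
    v ∈ unitsSubgroupImtrPre (F := F) hF.isPreFrobenioid A ↔
      v ∈ unitsSubgroup F A ∧ ∀ ⦃X : C⦄ (ι : X ⟶ A), IsIsometricPreStep F ι →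
        ∃ n : X ≅ X, n.hom ≫ ι = ι ≫ v.hom := by
  have hP : IsPreFrobenioid Φ F := hF.isPreFrobenioid
  constructor
  · rintro ⟨hv, ⟨e⟩⟩
    refine ⟨hv, fun X ι hι => ?_⟩
    let U : Over (⟨A⟩ : ImtrPreCat F) := Over.mk (Y := (⟨X⟩ : ImtrPreCat F)) ⟨ι, hι⟩
    let i : (Over.map (autToImtrPreHom hP v)).obj U ≅ U := e.app U
    let j : X ≅ X := (wideSubcategoryInclusion _).mapIso ((Over.forget _).mapIso i)
    refine ⟨j, ?_⟩
    have := congrArg InducedWideCategory.Hom.hom (Over.w i.hom)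
    exact this
  · rintro ⟨hv, h⟩
    refine ⟨hv, ⟨?_⟩⟩
    haveI : ∀ X Y : Over (⟨A⟩ : ImtrPreCat F), Subsingleton (X ⟶ Y) :=
      subsingleton_hom_over_imtrPre hF
    refine NatIso.ofComponents (fun U => ?_) (fun _ => Subsingleton.elim _ _)
    obtain ⟨n, hn⟩ := Classical.indefiniteDescription _ (h U.hom.1 U.hom.2)
    exact Over.isoMk (isoMk n (isIsometricPreStep_of_isIso hP n.hom)
      (isIsometricPreStep_of_isIso hP n.inv)) (InducedWideCategory.Hom.ext hn)

end PreFrobenioid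

end Literature.AlgebraicGeometry.Frobenioids
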